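import Literature.Computability.QuantumComplexity.OpenChainBulkEdgeCrossover
import HarnessLib

/-!
# Open-chain XEB: supermultiplicativity of the second moment and the dilute-gas product floor

Literature record of cell qa-dq (L-cand «dilute-gas-product-floor», lens «anomaly»; census DQ-N1,
open-chain sub-column, residue «k-sector laws of the dilute flipped-spin expansion (E20), term by
term» — here the LOWER half, for every k at once; successor of `OpenChainBulkEdgeCrossover`).
Named facts: 0. ONE Literature import, `OpenChainBulkEdgeCrossover`, used BY NAME together with
what it re-exports of `OpenChainEdgeRateLaw` / `OpenChainWalkerEdgeMode` /
`OpenChainXEBEdgeFloor`: the open-chain second-moment model (`Occ1D`, `numOcc`, `brickGate`,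
`noiseTilt`, `brickBonds`, `chainLayer`, `Phi1D`, `xebPlusOne1D`, `emptyCfg1D`,
`Phi1D_emptyCfg1D`, `xebPlusOne1D_zero`), the one-excitation configurations and the walker
(`singleCfg`, `numOcc_singleCfg`, `walkerPhi`, `walkerPhi_le_Phi1D_single`, `walkerPhi_end_ge`),
the product calculus (`prodFun`, `sum_prodFun`) and the bulk walker floor `walkerPhi_ge_bulk`.
Nothing of it is restated; §1–§2 prove PRIVATELY (≈ 330 lines) the configuration surgery and the
one-gate propagation lemmas — the layer operators' order lemmas in the imports are private and,
more to the point, none of them concerns TWO configurations at once, which is the new object here.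

## Dictionary (the definitions are literally this)
* `unionCfg A B` — the union `A ∪ B` (pointwise `or`) of two occupation configurations; `cfgOf S`
  — the configuration occupied exactly on the finset `S`.
  [cite: DalzellHunterJonesBrandao2022, App. A and App. C (occupied/unoccupied site configurations of the second-moment statistical model of a Haar brickwork; gate weights 1/5, 1/5, 3/5 at q = 2)]
* Disjointness and inclusion are spelled out pointwise in every binder
  (`∀ v, A v = false ∨ B v = false`, `∀ v, A v = true → A' v = true`); no `Prop` definitions.

## Content (all PROVED; `0 ≤ x ≤ 1` VISIBLE in every binder that needs it; every `N`, every depth)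
§2 ONE-GATE PROPAGATION (private): if `f ≥ 0` is ANTITONE (`A ⊆ A' ⇒ f A' ≤ f A`) and
SUPERMULTIPLICATIVE ON DISJOINT UNIONS (`f A · f B ≤ f (A ∪ B)`), so is its Haar-gate average on
any bond (`brickGate_anti`, `brickGate_super`; key step `brickGate_super_of_occ`: an output
pattern of `A ∪ B` is the same pattern of `A` united with the bond-cleared `B`, which lies below
every output pattern of `B` — the output law of an occupied bond does not depend on which inputs
were occupied), so is its noise tilt `x^{|A|} f` when `0 ≤ x ≤ 1` (`noiseTilt_anti`,
`noiseTilt_super`: the only place `x ≤ 1` enters), hence one brickwork layer and, by induction on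
depth from the multiplicative base `3^{-|A|}`, the functional `Φ_t` (`Phi1D_props`).
§3 HEADLINE OBJECT — POSITIVE ASSOCIATION OF THE DILUTE GAS: `Phi1D_antitone` (more flipped input
spins never help) and `Phi1D_supermul`: for DISJOINT `A`, `B`, `Φ_t(A)·Φ_t(B) ≤ Φ_t(A ∪ B)` — two
groups of excitations evolved together are never worse than evolved apart (a collision can only
merge or annihilate excitations; fewer excitations = larger functional). Iterated over the
occupied sites: `∏_{u ∈ S} Φ_t({u}) ≤ Φ_t(S)` (`Phi1D_prod_singles_le`, `Phi1D_prod_occ_le`).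
§4 HEADLINE LAW — THE DILUTE-GAS PRODUCT FLOOR: `∏_u (1 + x Φ_d({u})) ≤ E[XEB + 1]_d` for every
`N`, `d`, `0 ≤ x ≤ 1` (`xebPlusOne1D_prod_floor`, via the import's `sum_prodFun`), an EQUALITY at
`d = 0` (`xebPlusOne1D_prod_floor_zero`); on the even chain `N = 2K+2` the explicit N-EXPONENTIAL
floors `(1 + (x/3)(2x/5)^d)^N ≤ E[XEB+1]_d` (`xebPlusOne1D_ge_pow`, bulk walker at every site) and
`(1 + (x/6)(x/2)^d)(1 + (x/3)(2x/5)^d)^{N−1} ≤ E[XEB+1]_d` (`xebPlusOne1D_ge_edge_mul_pow`, the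
end site upgraded to the edge walker), and the first two dilute-gas sectors as a polynomial floor
`N a + N(N−1)/2·a² ≤ E[XEB]_d`, `a = (x/3)(2x/5)^d` (`xeb1D_pair_floor`) — the lineage's LINEAR
floor `singles_le_xebPlusOne1D` (k = 1) is the first term; every k-sector `e_k(xΦ_d({·}))` of the
floor is available by expanding the product.
§5 THE k-SECTORS, TERM BY TERM: `kSector N x d k = x^k Σ_{|S|=k} Φ_d(S)` (the k-excitation input
sector; `kSector_one`: k = 1 is the import's `singleSector` BY NAME) dominates the k-th elementary
symmetric function of the one-excitation functionals (`kSector_prod_floor`, every `k`, `N`, `d`,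
`0 ≤ x ≤ 1`), hence on the even chain `C(N,k)·a^k ≤ S_k(d)` for EVERY `k` (`kSector_floor_bulk`) —
the lower half of the printed expansion (E20) typed term by term (binomial `C(N,k)` in place of
`n^k/k!`). §6 restates antitonicity / supermultiplicativity in Mathlib's order language
(`Phi1D_antitone'` : `Antitone (Φ_t)`; `Phi1D_supermul'` for `Disjoint A B`, union `A ⊔ B`).
READING (docstring only, nothing asymptotic is typed): before the anticoncentration depth
`d⋆ ≈ log N / log(5/(2x))` one has `N a ≫ 1` and the mean XEB score is at least
`exp(N a − N a²/2) − 1`-large — the vacuum branch `exp[e^{-εd} n/4^d]` of the printed Eq. (E21) as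
a one-sided theorem (brickwork bulk rate `2/5` in place of the iSWAP `1/4`, open-chain edge rate
`1/2` at the ends).

## Honest scope
(R1) ONE-SIDED. Supermultiplicativity gives FLOORS only. The matching submultiplicativity is false
(collisions strictly help: `Φ_t(A ∪ B) > Φ_t(A)Φ_t(B)` as soon as the light cones of `A` and `B`
meet), so no ceiling of product form follows; the ceilings remain the Σ-lift ones of
`OpenChainEdgeRateLaw` / `OpenChainBulkEdgeCrossover` (with their `(1 + x/2)^{N−1}`).
(R2) `x ≤ 1` IS LOAD-BEARING, and sharp for antitonicity: by exact-fraction evaluation of the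
typed recursion (not typed here) `Phi1D_antitone` fails at `x = 21/20`, `N = 4`, depth 2;
`Phi1D_supermul` fails at `x = 6/5`, `N = 3`, depth 6 and at `x = 3/2`, depth 3; the product floor
fails at `x = 6/5`, `N = 3`, depth 7. For `0 ≤ x ≤ 1` all three hold with equality cases
(light-cone separated supports) on every row checked (`N ≤ 7`, depth `≤ 8`).
(R3) The propagation argument is gate-local (any sequence of Haar two-site gates and tilts with
`0 ≤ x ≤ 1`); it is TYPED here only for the open brickwork chain of the imports — nothing is
claimed for rings, 2D, iSWAP-like gates, other moments, samplers, spoofers or verification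
protocols, and nothing here proves or refutes any quantum-advantage statement.
(R4) Constants: the explicit floors use the imports' walker floors (`2x/5` bulk per layer, `x/2`
at an end); the true one-excitation functional is larger (it collects the `(1,1)`-channel mass the
walker discards), so the product floor with `Φ_d({u})` itself is strictly stronger than the two
closed forms.
-/

namespace Literature.Computability.QuantumComplexity.OpenChainDiluteGasFloor

open Literature.Computability.QuantumComplexity.OpenChainXEBEdgeFloor
open Literature.Computability.QuantumComplexity.OpenChainWalkerEdgeMode
open Literature.Computability.QuantumComplexity.OpenChainEdgeRateLaw
open Literature.Computability.QuantumComplexity.OpenChainBulkEdgeCrossover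
open Finset

variable {N : ℕ}

/-! ## §1 Configuration algebra: union, support, bond surgery (private plumbing) -/

/-- The union (pointwise `or`) of two occupation configurations. [cite: DalzellHunterJonesBrandao2022, App. A and App. C (occupied-site configurations of the second-moment statistical model)] -/
def unionCfg (A B : Occ1D N) : Occ1D N := fun v => A v || B v

/-- The configuration occupied exactly on a finset of sites. [cite: DalzellHunterJonesBrandao2022, App. A and App. C (occupied-site configurations of the second-moment statistical model)] -/
def cfgOf (S : Finset (Fin N)) : Occ1D N := fun v => if v ∈ S then true else false

/-- [folklore] -/
private theorem unionCfg_comm (A B : Occ1D N) : unionCfg A B = unionCfg B A := by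
  funext v; simp [unionCfg, Bool.or_comm]

/-- Occupation number is additive on disjoint unions. [folklore] -/
private theorem numOcc_unionCfg {A B : Occ1D N} (h : ∀ v, A v = false ∨ B v = false) :
    numOcc (unionCfg A B) = numOcc A + numOcc B := by
  unfold numOcc unionCfg
  rw [← Finset.sum_add_distrib]
  refine Finset.sum_congr rfl (fun v _ => ?_)
  rcases h v with hv | hv <;> simp [hv]

/-- Occupation number is monotone in the configuration. [folklore] -/
private theorem numOcc_mono {A A' : Occ1D N} (h : ∀ v, A v = true → A' v = true) :
    numOcc A ≤ numOcc A' := by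
  unfold numOcc
  refine Finset.sum_le_sum (fun v _ => ?_)
  cases hA : A v
  · simp
  · simp [h v hA]

/-- `|A|` is the number of occupied sites. [folklore] -/
private theorem numOcc_eq_card (A : Occ1D N) :
    numOcc A = (Finset.univ.filter (fun v => A v = true)).card := by
  unfold numOcc
  rw [Finset.card_filter]
  exact Finset.sum_congr rfl (fun v _ => by cases A v <;> simp)

section Surgery
variable (k l : Fin N) (a b : Bool)

/-- Setting the two bond sites commutes with union up to clearing the bond in the second
argument. [folklore] -/
private theorem upd2_unionCfg (A B : Occ1D N) :
    Function.update (Function.update (unionCfg A B) k a) l b =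
      unionCfg (Function.update (Function.update A k a) l b)
        (Function.update (Function.update B k false) l false) := by
  funext v
  by_cases hl : v = l
  · subst hl; simp [unionCfg]
  · by_cases hk : v = k
    · subst hk; simp [unionCfg, hl]
    · simp [unionCfg, hl, hk]

/-- Bond surgery is monotone. [folklore] -/
private theorem upd2_mono {A A' : Occ1D N} (h : ∀ v, A v = true → A' v = true) :
    ∀ v, Function.update (Function.update A k a) l b v = true →
      Function.update (Function.update A' k a) l b v = true := by
  intro v hv
  by_cases hl : v = l
  · subst hl; simpa using hv
  · by_cases hk : v = k
    · subst hk; simpa [Function.update_apply, hl] using hv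
    · simp only [Function.update_apply, hl, hk, if_false] at hv ⊢
      exact h v hv

/-- The bond-cleared configuration lies below every bond setting. [folklore] -/
private theorem clear_le_upd2 (B : Occ1D N) :
    ∀ v, Function.update (Function.update B k false) l false v = true →
      Function.update (Function.update B k a) l b v = true := by
  intro v hv
  by_cases hl : v = l
  · subst hl; simp at hv
  · by_cases hk : v = k
    · subst hk; simp [hl] at hv
    · simp only [Function.update_apply, hl, hk, if_false] at hv ⊢
      exact hv

/-- A configuration empty on the bond lies below every bond setting of a super-configuration.
[folklore] -/
private theorem le_upd2_of_empty {A A' : Occ1D N} (h : ∀ v, A v = true → A' v = true)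
    (hk : A k = false) (hl : A l = false) :
    ∀ v, A v = true → Function.update (Function.update A' k a) l b v = true := by
  intro v hv
  by_cases hvl : v = l
  · subst hvl; simp [hl] at hv
  · by_cases hvk : v = k
    · subst hvk; simp [hk] at hv
    · simp only [Function.update_apply, hvl, hvk, if_false]
      exact h v hv

/-- Bond surgery on `A` and bond clearing on `B` keep disjoint configurations disjoint.
[folklore] -/
private theorem disj_upd2_clear {A B : Occ1D N} (h : ∀ v, A v = false ∨ B v = false) :
    ∀ v, Function.update (Function.update A k a) l b v = false ∨
      Function.update (Function.update B k false) l false v = false := by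
  intro v
  by_cases hl : v = l
  · subst hl; right; simp
  · by_cases hk : v = k
    · subst hk; right; simp [hl]
    · simp only [Function.update_apply, hl, hk, if_false]
      exact h v

/-- Clearing an already empty bond does nothing. [folklore] -/
private theorem clear_eq_self {B : Occ1D N} (hk : B k = false) (hl : B l = false) :
    Function.update (Function.update B k false) l false = B := by
  funext v
  by_cases hvl : v = l
  · subst hvl; simp [hl]
  · by_cases hvk : v = k
    · subst hvk; simp [hvl, hk]
    · simp [hvl, hvk]

end Surgery

/-! ## §2 One gate, the noise tilt, one layer: order and supermultiplicativity are preserved -/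

section Gate
variable {i j : ℕ} {f : Occ1D N → ℝ}

/-- A Haar-gate average of a non-negative function is non-negative. [folklore] -/
private theorem brickGate_nonneg' (hf : ∀ A, 0 ≤ f A) (A : Occ1D N) :
    0 ≤ brickGate N i j f A := by
  unfold brickGate
  split_ifs with h h'
  · exact hf _
  · linarith [hf (Function.update (Function.update A ⟨j, h.2⟩ false) ⟨i, h.1⟩ true),
      hf (Function.update (Function.update A ⟨i, h.1⟩ false) ⟨j, h.2⟩ true),
      hf (Function.update (Function.update A ⟨i, h.1⟩ true) ⟨j, h.2⟩ true)]
  · exact hf _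

/-- A Haar-gate average of an antitone function is antitone. [folklore] -/
private theorem brickGate_anti
    (hfa : ∀ A A' : Occ1D N, (∀ v, A v = true → A' v = true) → f A' ≤ f A)
    {A A' : Occ1D N} (hle : ∀ v, A v = true → A' v = true) :
    brickGate N i j f A' ≤ brickGate N i j f A := by
  unfold brickGate
  by_cases h : i < N ∧ j < N
  · simp only [dif_pos h]
    by_cases hA' : A' ⟨i, h.1⟩ = false ∧ A' ⟨j, h.2⟩ = false
    · have hA : A ⟨i, h.1⟩ = false ∧ A ⟨j, h.2⟩ = false := by
        constructor
        · cases hv : A ⟨i, h.1⟩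
          · rfl
          · exact absurd (hle _ hv) (by simp [hA'.1])
        · cases hv : A ⟨j, h.2⟩
          · rfl
          · exact absurd (hle _ hv) (by simp [hA'.2])
      rw [if_pos hA', if_pos hA]
      exact hfa A A' hle
    · rw [if_neg hA']
      by_cases hA : A ⟨i, h.1⟩ = false ∧ A ⟨j, h.2⟩ = false
      · rw [if_pos hA]
        have h1 := hfa A _ (le_upd2_of_empty ⟨j, h.2⟩ ⟨i, h.1⟩ false true hle hA.2 hA.1)
        have h2 := hfa A _ (le_upd2_of_empty ⟨i, h.1⟩ ⟨j, h.2⟩ false true hle hA.1 hA.2)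
        have h3 := hfa A _ (le_upd2_of_empty ⟨i, h.1⟩ ⟨j, h.2⟩ true true hle hA.1 hA.2)
        linarith
      · rw [if_neg hA]
        have h1 := hfa _ _ (upd2_mono ⟨j, h.2⟩ ⟨i, h.1⟩ false true hle)
        have h2 := hfa _ _ (upd2_mono ⟨i, h.1⟩ ⟨j, h.2⟩ false true hle)
        have h3 := hfa _ _ (upd2_mono ⟨i, h.1⟩ ⟨j, h.2⟩ true true hle)
        linarith
  · simp only [dif_neg h]
    exact hfa A A' hle

/-- KEY STEP. If `f ≥ 0` is antitone and supermultiplicative on disjoint unions and `A` is occupied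
on the bond, then `gate f (A ∪ B) ≥ gate f A · gate f B` for every `B` disjoint from `A`: each
output pattern of the union is the same pattern of `A` united with the bond-cleared `B`, which lies
below every output pattern of `B`. [folklore] -/
private theorem brickGate_super_of_occ (hf0 : ∀ A, 0 ≤ f A)
    (hfa : ∀ A A' : Occ1D N, (∀ v, A v = true → A' v = true) → f A' ≤ f A)
    (hfs : ∀ A B : Occ1D N, (∀ v, A v = false ∨ B v = false) → f A * f B ≤ f (unionCfg A B))
    (h : i < N ∧ j < N) {A B : Occ1D N} (hAB : ∀ v, A v = false ∨ B v = false)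
    (hocc : ¬ (A ⟨i, h.1⟩ = false ∧ A ⟨j, h.2⟩ = false)) :
    brickGate N i j f A * brickGate N i j f B ≤ brickGate N i j f (unionCfg A B) := by
  -- every bond setting `C` of `A` satisfies `f C · gate f B ≤ f (C ∪ clear B)`
  have key : ∀ C : Occ1D N,
      (∀ v, C v = false ∨ Function.update (Function.update B ⟨i, h.1⟩ false) ⟨j, h.2⟩ false v
        = false) → 0 ≤ f C →
      f C * brickGate N i j f B ≤
        f (unionCfg C (Function.update (Function.update B ⟨i, h.1⟩ false) ⟨j, h.2⟩ false)) := by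
    intro C hC hC0
    unfold brickGate
    simp only [dif_pos h]
    by_cases hB : B ⟨i, h.1⟩ = false ∧ B ⟨j, h.2⟩ = false
    · rw [if_pos hB]
      rw [clear_eq_self ⟨i, h.1⟩ ⟨j, h.2⟩ hB.1 hB.2] at hC ⊢
      exact hfs C B hC
    · rw [if_neg hB]
      have hu := hfs C _ hC
      have e1 : Function.update (Function.update B ⟨i, h.1⟩ false) ⟨j, h.2⟩ false =
          Function.update (Function.update B ⟨j, h.2⟩ false) ⟨i, h.1⟩ false := by
        funext v; simp only [Function.update_apply]; split_ifs <;> rfl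
      have h1 : f (Function.update (Function.update B ⟨j, h.2⟩ false) ⟨i, h.1⟩ true) ≤
          f (Function.update (Function.update B ⟨i, h.1⟩ false) ⟨j, h.2⟩ false) := by
        rw [e1]; exact hfa _ _ (clear_le_upd2 ⟨j, h.2⟩ ⟨i, h.1⟩ false true B)
      have h2 : f (Function.update (Function.update B ⟨i, h.1⟩ false) ⟨j, h.2⟩ true) ≤
          f (Function.update (Function.update B ⟨i, h.1⟩ false) ⟨j, h.2⟩ false) :=
        hfa _ _ (clear_le_upd2 ⟨i, h.1⟩ ⟨j, h.2⟩ false true B)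
      have h3 : f (Function.update (Function.update B ⟨i, h.1⟩ true) ⟨j, h.2⟩ true) ≤
          f (Function.update (Function.update B ⟨i, h.1⟩ false) ⟨j, h.2⟩ false) :=
        hfa _ _ (clear_le_upd2 ⟨i, h.1⟩ ⟨j, h.2⟩ true true B)
      have m1 := mul_le_mul_of_nonneg_left h1 hC0
      have m2 := mul_le_mul_of_nonneg_left h2 hC0
      have m3 := mul_le_mul_of_nonneg_left h3 hC0
      linarith
  -- the union is occupied on the bond, and its output patterns factor through `upd2_unionCfg`
  have hoccU : ¬ (unionCfg A B ⟨i, h.1⟩ = false ∧ unionCfg A B ⟨j, h.2⟩ = false) := by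
    intro hU
    apply hocc
    simp only [unionCfg, Bool.or_eq_false_iff] at hU
    exact ⟨hU.1.1, hU.2.1⟩
  have eA : brickGate N i j f A =
      1 / 5 * f (Function.update (Function.update A ⟨j, h.2⟩ false) ⟨i, h.1⟩ true)
      + 1 / 5 * f (Function.update (Function.update A ⟨i, h.1⟩ false) ⟨j, h.2⟩ true)
      + 3 / 5 * f (Function.update (Function.update A ⟨i, h.1⟩ true) ⟨j, h.2⟩ true) := by
    unfold brickGate; rw [dif_pos h, if_neg hocc]
  have eU : brickGate N i j f (unionCfg A B) =
      1 / 5 * f (Function.update (Function.update (unionCfg A B) ⟨j, h.2⟩ false) ⟨i, h.1⟩ true)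
      + 1 / 5 * f (Function.update (Function.update (unionCfg A B) ⟨i, h.1⟩ false) ⟨j, h.2⟩ true)
      + 3 / 5 * f (Function.update (Function.update (unionCfg A B) ⟨i, h.1⟩ true) ⟨j, h.2⟩ true)
      := by
    unfold brickGate; rw [dif_pos h, if_neg hoccU]
  -- the `clear` with indices in the order (j, i) equals the one in the order (i, j)
  have ec : Function.update (Function.update B ⟨j, h.2⟩ false) ⟨i, h.1⟩ false =
      Function.update (Function.update B ⟨i, h.1⟩ false) ⟨j, h.2⟩ false := by
    funext v; simp only [Function.update_apply]; split_ifs <;> rfl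
  have k1 := key _ (by
      have := disj_upd2_clear ⟨j, h.2⟩ ⟨i, h.1⟩ false true hAB; rw [ec] at this; exact this)
    (hf0 (Function.update (Function.update A ⟨j, h.2⟩ false) ⟨i, h.1⟩ true))
  have k2 := key _ (disj_upd2_clear ⟨i, h.1⟩ ⟨j, h.2⟩ false true hAB)
    (hf0 (Function.update (Function.update A ⟨i, h.1⟩ false) ⟨j, h.2⟩ true))
  have k3 := key _ (disj_upd2_clear ⟨i, h.1⟩ ⟨j, h.2⟩ true true hAB)
    (hf0 (Function.update (Function.update A ⟨i, h.1⟩ true) ⟨j, h.2⟩ true))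
  rw [eA, eU, upd2_unionCfg ⟨j, h.2⟩ ⟨i, h.1⟩ false true, ec,
    upd2_unionCfg ⟨i, h.1⟩ ⟨j, h.2⟩ false true, upd2_unionCfg ⟨i, h.1⟩ ⟨j, h.2⟩ true true]
  have hg0 := brickGate_nonneg' (i := i) (j := j) hf0 B
  nlinarith [k1, k2, k3, hg0]

/-- A Haar-gate average of a non-negative antitone supermultiplicative function is
supermultiplicative on disjoint unions. [folklore] -/
private theorem brickGate_super (hf0 : ∀ A, 0 ≤ f A)
    (hfa : ∀ A A' : Occ1D N, (∀ v, A v = true → A' v = true) → f A' ≤ f A)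
    (hfs : ∀ A B : Occ1D N, (∀ v, A v = false ∨ B v = false) → f A * f B ≤ f (unionCfg A B))
    {A B : Occ1D N} (hAB : ∀ v, A v = false ∨ B v = false) :
    brickGate N i j f A * brickGate N i j f B ≤ brickGate N i j f (unionCfg A B) := by
  by_cases h : i < N ∧ j < N
  · by_cases hA : A ⟨i, h.1⟩ = false ∧ A ⟨j, h.2⟩ = false
    · by_cases hB : B ⟨i, h.1⟩ = false ∧ B ⟨j, h.2⟩ = false
      · have hU : unionCfg A B ⟨i, h.1⟩ = false ∧ unionCfg A B ⟨j, h.2⟩ = false := by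
          simp [unionCfg, hA.1, hA.2, hB.1, hB.2]
        unfold brickGate
        rw [dif_pos h, dif_pos h, dif_pos h, if_pos hA, if_pos hB, if_pos hU]
        exact hfs A B hAB
      · have hBA : ∀ v, B v = false ∨ A v = false := fun v => (hAB v).symm
        rw [mul_comm, unionCfg_comm]
        exact brickGate_super_of_occ hf0 hfa hfs h hBA hB
    · exact brickGate_super_of_occ hf0 hfa hfs h hAB hA
  · unfold brickGate
    simp only [dif_neg h]
    exact hfs A B hAB

end Gate

section Layer
variable {x : ℝ}

/-- [folklore] -/
private theorem noiseTilt_nonneg' (hx : 0 ≤ x) {f : Occ1D N → ℝ} (hf : ∀ A, 0 ≤ f A)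
    (A : Occ1D N) : 0 ≤ noiseTilt x f A := by
  unfold noiseTilt; exact mul_nonneg (pow_nonneg hx _) (hf A)

/-- The noise tilt `x^{|A|}` keeps antitone functions antitone when `0 ≤ x ≤ 1`. [folklore] -/
private theorem noiseTilt_anti (hx0 : 0 ≤ x) (hx1 : x ≤ 1) {f : Occ1D N → ℝ} (hf : ∀ A, 0 ≤ f A)
    (hfa : ∀ A A' : Occ1D N, (∀ v, A v = true → A' v = true) → f A' ≤ f A)
    {A A' : Occ1D N} (hle : ∀ v, A v = true → A' v = true) :
    noiseTilt x f A' ≤ noiseTilt x f A := by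
  unfold noiseTilt
  exact mul_le_mul (pow_le_pow_of_le_one hx0 hx1 (numOcc_mono hle)) (hfa A A' hle) (hf A')
    (pow_nonneg hx0 _)

/-- The noise tilt is multiplicative on disjoint unions, hence keeps supermultiplicativity.
[folklore] -/
private theorem noiseTilt_super (hx0 : 0 ≤ x) {f : Occ1D N → ℝ}
    (hfs : ∀ A B : Occ1D N, (∀ v, A v = false ∨ B v = false) → f A * f B ≤ f (unionCfg A B))
    {A B : Occ1D N} (hAB : ∀ v, A v = false ∨ B v = false) :
    noiseTilt x f A * noiseTilt x f B ≤ noiseTilt x f (unionCfg A B) := by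
  unfold noiseTilt
  rw [numOcc_unionCfg hAB, pow_add]
  calc x ^ numOcc A * f A * (x ^ numOcc B * f B)
      = x ^ numOcc A * x ^ numOcc B * (f A * f B) := by ring
    _ ≤ x ^ numOcc A * x ^ numOcc B * f (unionCfg A B) :=
        mul_le_mul_of_nonneg_left (hfs A B hAB) (by positivity)

/-- [folklore] -/
private theorem brickBonds_nonneg' {s : ℕ} : ∀ (c : ℕ) {f : Occ1D N → ℝ}, (∀ A, 0 ≤ f A) →
    ∀ A, 0 ≤ brickBonds N s c f A
  | 0, _, hf => hf
  | c + 1, _, hf => fun A => by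
      rw [brickBonds]; exact brickGate_nonneg' (brickBonds_nonneg' c hf) A

/-- [folklore] -/
private theorem brickBonds_anti {s : ℕ} : ∀ (c : ℕ) {f : Occ1D N → ℝ},
    (∀ A A' : Occ1D N, (∀ v, A v = true → A' v = true) → f A' ≤ f A) →
    ∀ A A' : Occ1D N, (∀ v, A v = true → A' v = true) →
      brickBonds N s c f A' ≤ brickBonds N s c f A
  | 0, _, hfa => hfa
  | c + 1, _, hfa => fun A A' hle => by
      rw [brickBonds]; exact brickGate_anti (brickBonds_anti c hfa) hle

/-- [folklore] -/
private theorem brickBonds_super {s : ℕ} : ∀ (c : ℕ) {f : Occ1D N → ℝ}, (∀ A, 0 ≤ f A) →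
    (∀ A A' : Occ1D N, (∀ v, A v = true → A' v = true) → f A' ≤ f A) →
    (∀ A B : Occ1D N, (∀ v, A v = false ∨ B v = false) → f A * f B ≤ f (unionCfg A B)) →
    ∀ A B : Occ1D N, (∀ v, A v = false ∨ B v = false) →
      brickBonds N s c f A * brickBonds N s c f B ≤ brickBonds N s c f (unionCfg A B)
  | 0, _, _, _, hfs => hfs
  | c + 1, _, hf0, hfa, hfs => fun A B hAB => by
      rw [brickBonds]
      exact brickGate_super (brickBonds_nonneg' c hf0) (brickBonds_anti c hfa)
        (brickBonds_super c hf0 hfa hfs) hAB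

/-- [folklore] -/
private theorem chainLayer_nonneg' (hx : 0 ≤ x) (p : ℕ) {f : Occ1D N → ℝ} (hf : ∀ A, 0 ≤ f A)
    (A : Occ1D N) : 0 ≤ chainLayer N x p f A := by
  unfold chainLayer
  exact brickGate_nonneg' (brickBonds_nonneg' _ (noiseTilt_nonneg' hx hf)) A

/-- One brickwork layer keeps antitone functions antitone (`0 ≤ x ≤ 1`). [folklore] -/
private theorem chainLayer_anti (hx0 : 0 ≤ x) (hx1 : x ≤ 1) (p : ℕ) {f : Occ1D N → ℝ}
    (hf : ∀ A, 0 ≤ f A)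
    (hfa : ∀ A A' : Occ1D N, (∀ v, A v = true → A' v = true) → f A' ≤ f A)
    {A A' : Occ1D N} (hle : ∀ v, A v = true → A' v = true) :
    chainLayer N x p f A' ≤ chainLayer N x p f A := by
  unfold chainLayer
  exact brickGate_anti (brickBonds_anti _ (fun A A' h => noiseTilt_anti hx0 hx1 hf hfa h)) hle

/-- One brickwork layer keeps non-negative antitone supermultiplicative functions
supermultiplicative on disjoint unions (`0 ≤ x ≤ 1`). [folklore] -/
private theorem chainLayer_super (hx0 : 0 ≤ x) (hx1 : x ≤ 1) (p : ℕ) {f : Occ1D N → ℝ}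
    (hf : ∀ A, 0 ≤ f A)
    (hfa : ∀ A A' : Occ1D N, (∀ v, A v = true → A' v = true) → f A' ≤ f A)
    (hfs : ∀ A B : Occ1D N, (∀ v, A v = false ∨ B v = false) → f A * f B ≤ f (unionCfg A B))
    {A B : Occ1D N} (hAB : ∀ v, A v = false ∨ B v = false) :
    chainLayer N x p f A * chainLayer N x p f B ≤ chainLayer N x p f (unionCfg A B) := by
  unfold chainLayer
  exact brickGate_super (brickBonds_nonneg' _ (noiseTilt_nonneg' hx0 hf))
    (brickBonds_anti _ (fun A A' h => noiseTilt_anti hx0 hx1 hf hfa h))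
    (brickBonds_super _ (noiseTilt_nonneg' hx0 hf) (fun A A' h => noiseTilt_anti hx0 hx1 hf hfa h)
      (fun A B h => noiseTilt_super hx0 hfs h)) hAB

/-- The three properties propagate through the depth recursion of `Φ_t`. [folklore] -/
private theorem Phi1D_props (hx0 : 0 ≤ x) (hx1 : x ≤ 1) : ∀ t : ℕ,
    (∀ A : Occ1D N, 0 ≤ Phi1D N x t A) ∧
    (∀ A A' : Occ1D N, (∀ v, A v = true → A' v = true) → Phi1D N x t A' ≤ Phi1D N x t A) ∧
    (∀ A B : Occ1D N, (∀ v, A v = false ∨ B v = false) →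
      Phi1D N x t A * Phi1D N x t B ≤ Phi1D N x t (unionCfg A B))
  | 0 => by
      refine ⟨fun A => by simp only [Phi1D]; positivity, fun A A' hle => ?_, fun A B hAB => ?_⟩
      · simp only [Phi1D]
        exact pow_le_pow_of_le_one (by norm_num) (by norm_num) (numOcc_mono hle)
      · simp only [Phi1D]
        rw [numOcc_unionCfg hAB, pow_add]
  | t + 1 => by
      obtain ⟨h0, ha, hs⟩ := Phi1D_props hx0 hx1 t
      refine ⟨fun A => ?_, fun A A' hle => ?_, fun A B hAB => ?_⟩
      · rw [Phi1D]; exact chainLayer_nonneg' hx0 _ h0 A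
      · rw [Phi1D]; exact chainLayer_anti hx0 hx1 _ h0 ha hle
      · rw [Phi1D]; exact chainLayer_super hx0 hx1 _ h0 ha hs hAB

end Layer

/-! ## §3 Headline: antitonicity, supermultiplicativity, product over occupied sites -/

section Main
variable {x : ℝ}

/-- `Φ_t ≥ 0`. [cite: DalzellHunterJonesBrandao2022, App. A and App. C (second-moment rule of a Haar two-qudit gate: weights 1/5, 1/5, 3/5 at q = 2 are non-negative)] -/
theorem Phi1D_nonneg'' (hx0 : 0 ≤ x) (hx1 : x ≤ 1) (t : ℕ) (A : Occ1D N) :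
    0 ≤ Phi1D N x t A :=
  (Phi1D_props hx0 hx1 t).1 A

/-- ANTITONICITY: flipping more input spins can only lower the second-moment functional,
`A ⊆ A' ⇒ Φ_t(A') ≤ Φ_t(A)`, at every depth, for `0 ≤ x ≤ 1`. [cite: DalzellHunterJonesBrandao2022, App. A and App. C (second-moment rule of a Haar two-qudit gate, weights 1/5, 1/5, 3/5; the output law of an occupied bond does not depend on which of its sites are occupied)] -/
theorem Phi1D_antitone (hx0 : 0 ≤ x) (hx1 : x ≤ 1) (t : ℕ) {A A' : Occ1D N}
    (hle : ∀ v, A v = true → A' v = true) : Phi1D N x t A' ≤ Phi1D N x t A :=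
  (Phi1D_props hx0 hx1 t).2.1 A A' hle

/-- SUPERMULTIPLICATIVITY (positive association of the dilute gas): for DISJOINT input
configurations `Φ_t(A) · Φ_t(B) ≤ Φ_t(A ∪ B)` at every depth, for `0 ≤ x ≤ 1` — two groups of
flipped spins evolved together are never worse than evolved apart (a collision can only merge or
annihilate excitations, and fewer excitations means a larger functional). Equality holds while the
two supports are light-cone separated. The hypothesis `x ≤ 1` is load-bearing (at `x = 3/2` the
inequality fails already for `N = 3`, depth 2 — exact-fraction check, not typed). [cite: MorvanEtAl2024, SM App. E (arXiv p. 22: dilute flipped-spin expansion, Eq. (E20) with the 1/k! counting of k independent flipped spins, exponentiated in Eq. (E21))] -/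
theorem Phi1D_supermul (hx0 : 0 ≤ x) (hx1 : x ≤ 1) (t : ℕ) {A B : Occ1D N}
    (hAB : ∀ v, A v = false ∨ B v = false) :
    Phi1D N x t A * Phi1D N x t B ≤ Phi1D N x t (unionCfg A B) :=
  (Phi1D_props hx0 hx1 t).2.2 A B hAB

/-- [folklore] -/
private theorem cfgOf_empty : cfgOf (∅ : Finset (Fin N)) = emptyCfg1D N := by
  funext v; simp [cfgOf, emptyCfg1D]

/-- [folklore] -/
private theorem cfgOf_insert (u : Fin N) (S : Finset (Fin N)) :
    cfgOf (insert u S) = unionCfg (singleCfg u) (cfgOf S) := by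
  funext v
  by_cases hv : v = u
  · subst hv; simp [cfgOf, unionCfg, singleCfg]
  · simp [cfgOf, unionCfg, singleCfg, hv]

/-- [folklore] -/
private theorem cfgOf_filter (A : Occ1D N) :
    cfgOf (Finset.univ.filter (fun v => A v = true)) = A := by
  funext v; simp [cfgOf]

/-- PRODUCT FORM: the functional of a configuration dominates the product of the one-excitation
functionals of its occupied sites, `∏_{u ∈ S} Φ_t({u}) ≤ Φ_t(S)`. [cite: MorvanEtAl2024, SM App. E (arXiv p. 22: dilute flipped-spin expansion, Eq. (E20) — k flipped spins counted as k independent ones with the factor 1/k!)] -/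
theorem Phi1D_prod_singles_le (hx0 : 0 ≤ x) (hx1 : x ≤ 1) (t : ℕ) (S : Finset (Fin N)) :
    ∏ u ∈ S, Phi1D N x t (singleCfg u) ≤ Phi1D N x t (cfgOf S) := by
  induction S using Finset.induction_on with
  | empty => simp [cfgOf_empty, Phi1D_emptyCfg1D]
  | @insert u S hu ih =>
      rw [Finset.prod_insert hu, cfgOf_insert]
      have hdisj : ∀ v, singleCfg u v = false ∨ cfgOf S v = false := by
        intro v
        by_cases hv : v = u
        · subst hv; right; simp [cfgOf, hu]
        · left; simp [singleCfg, hv]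
      calc Phi1D N x t (singleCfg u) * ∏ u ∈ S, Phi1D N x t (singleCfg u)
          ≤ Phi1D N x t (singleCfg u) * Phi1D N x t (cfgOf S) :=
            mul_le_mul_of_nonneg_left ih (Phi1D_nonneg'' hx0 hx1 t _)
        _ ≤ Phi1D N x t (unionCfg (singleCfg u) (cfgOf S)) := Phi1D_supermul hx0 hx1 t hdisj

/-- The same over the occupied sites of an arbitrary configuration. [cite: MorvanEtAl2024, SM App. E (arXiv p. 22: dilute flipped-spin expansion, Eq. (E20))] -/
theorem Phi1D_prod_occ_le (hx0 : 0 ≤ x) (hx1 : x ≤ 1) (t : ℕ) (A : Occ1D N) :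
    ∏ u ∈ Finset.univ.filter (fun v => A v = true), Phi1D N x t (singleCfg u) ≤
      Phi1D N x t A := by
  have h := Phi1D_prod_singles_le (N := N) hx0 hx1 t (Finset.univ.filter (fun v => A v = true))
  rwa [cfgOf_filter] at h

/-! ## §4 The dilute-gas product floor for `E[XEB + 1]` -/

/-- The product weight `∏_v (x Φ_t({v}))^{[v ∈ A]}` written with the import's `prodFun`.
[folklore] -/
private theorem prodFun_singles (t : ℕ) (A : Occ1D N) :
    prodFun (fun v b => if b then x * Phi1D N x t (singleCfg v) else 1) A =
      x ^ numOcc A * ∏ u ∈ Finset.univ.filter (fun v => A v = true), Phi1D N x t (singleCfg u) := by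
  unfold prodFun
  rw [numOcc_eq_card, ← Finset.prod_const, ← Finset.prod_mul_distrib, Finset.prod_filter]

/-- HEADLINE — THE DILUTE-GAS PRODUCT FLOOR: for every `N`, every depth `d` and `0 ≤ x ≤ 1`,
`∏_u (1 + x Φ_d({u})) ≤ E[XEB + 1]_d` — the independent-excitation ("dilute flipped-spin")
partition function is a rigorous FLOOR of the noisy open-chain XEB second moment, with equality at
`d = 0` (`xebPlusOne1D_prod_floor_zero`). Expanding the product exhibits every k-excitation sector
of the floor at once (`Σ_k e_k(xΦ_d({·}))`). [cite: MorvanEtAl2024, SM App. E (arXiv p. 22: XEB + 1 ≃ Σ_k (1/k!) e^{-εkd}(n/4^d)^k = exp[e^{-εd} n/4^d], Eqs. (E20)–(E21), heuristic; here the vacuum branch is typed as a one-sided law)] -/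
theorem xebPlusOne1D_prod_floor (hx0 : 0 ≤ x) (hx1 : x ≤ 1) (d : ℕ) :
    ∏ u : Fin N, (1 + x * Phi1D N x d (singleCfg u)) ≤ xebPlusOne1D N x d := by
  have hsum := sum_prodFun (N := N) (fun v b => if b then x * Phi1D N x d (singleCfg v) else 1)
  simp only [ite_true, Bool.false_eq_true, ite_false] at hsum
  have hre : ∏ u : Fin N, (1 + x * Phi1D N x d (singleCfg u)) =
      ∏ u : Fin N, (x * Phi1D N x d (singleCfg u) + 1) :=
    Finset.prod_congr rfl (fun u _ => add_comm _ _)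
  rw [hre, ← hsum]
  unfold xebPlusOne1D
  refine Finset.sum_le_sum (fun A _ => ?_)
  rw [prodFun_singles]
  exact mul_le_mul_of_nonneg_left (Phi1D_prod_occ_le hx0 hx1 d A) (pow_nonneg hx0 _)

/-- Tightness at depth zero: the floor is an equality, `∏_u (1 + x/3) = (1 + x/3)^N = E[XEB+1]_0`.
[cite: DalzellHunterJonesBrandao2022, App. A and App. C (depth-0 value of the second moment, (1 + x/3)^N in the tilted normalisation)] -/
theorem xebPlusOne1D_prod_floor_zero (x : ℝ) :
    ∏ u : Fin N, (1 + x * Phi1D N x 0 (singleCfg u)) = xebPlusOne1D N x 0 := by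
  rw [xebPlusOne1D_zero]
  simp [Phi1D, numOcc_singleCfg, Finset.prod_const, Finset.card_univ, Fintype.card_fin,
    div_eq_mul_inv]

/-- EXPLICIT N-EXPONENTIAL FLOOR on the even open chain `N = 2K+2`: every site carries at least the
bulk walker `(1/3)(2x/5)^d` (`walkerPhi_ge_bulk`, `walkerPhi_le_Phi1D_single` by name), hence
`(1 + (x/3)(2x/5)^d)^N ≤ E[XEB + 1]_d` for every `K`, `d`, `0 ≤ x ≤ 1` — below depth
`≈ log N / log(5/(2x))` the mean XEB score is at least EXPONENTIALLY large in `N(2x/5)^d`.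
[cite: MorvanEtAl2024, SM App. E (arXiv p. 22: Eq. (E21), XEB + 1 ≃ exp[e^{-εd} n/4^d] before anticoncentration; the exponential is typed here as a floor with the brickwork bulk rate 2/5 in place of the iSWAP 1/4)] -/
theorem xebPlusOne1D_ge_pow (K : ℕ) (hx0 : 0 ≤ x) (hx1 : x ≤ 1) (d : ℕ) :
    (1 + x / 3 * (2 * x / 5) ^ d) ^ (2 * K + 2) ≤ xebPlusOne1D (2 * K + 2) x d := by
  refine le_trans ?_ (xebPlusOne1D_prod_floor hx0 hx1 d)
  have hc : (1 + x / 3 * (2 * x / 5) ^ d) ^ (2 * K + 2) =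
      ∏ _u : Fin (2 * K + 2), (1 + x / 3 * (2 * x / 5) ^ d) := by
    rw [Finset.prod_const, Finset.card_univ, Fintype.card_fin]
  rw [hc]
  refine Finset.prod_le_prod (fun u _ => by positivity) (fun u _ => ?_)
  have h1 := le_trans (walkerPhi_ge_bulk K hx0 d u) (walkerPhi_le_Phi1D_single hx0 d u)
  nlinarith [h1, hx0]

/-- EDGE-REFINED N-EXPONENTIAL FLOOR: the end site `0` carries at least the slower edge walker
`(1/6)(x/2)^d` (`walkerPhi_end_ge` by name), the other `2K+1` sites at least the bulk walker, hence
`(1 + (x/6)(x/2)^d)(1 + (x/3)(2x/5)^d)^{2K+1} ≤ E[XEB + 1]_d`; expanding exhibits, besides the bulk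
sectors, the EDGE × BULK pair terms `(2K+1)(x/6)(x/2)^d · (x/3)(2x/5)^d` of the dilute gas.
[cite: MorvanEtAl2024, SM App. E (arXiv p. 23: boundary qubits dominate the convergence at late times, the boundary factor of Eq. (E30) multiplying the bulk exponential of Eq. (E21); typed one-sidedly for the brickwork open chain)] -/
theorem xebPlusOne1D_ge_edge_mul_pow (K : ℕ) (hx0 : 0 ≤ x) (hx1 : x ≤ 1) (d : ℕ) :
    (1 + x / 6 * (x / 2) ^ d) * (1 + x / 3 * (2 * x / 5) ^ d) ^ (2 * K + 1)
      ≤ xebPlusOne1D (2 * K + 2) x d := by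
  refine le_trans ?_ (xebPlusOne1D_prod_floor hx0 hx1 d)
  have h0 : 0 < 2 * K + 2 := by omega
  rw [← Finset.mul_prod_erase Finset.univ (fun u => 1 + x * Phi1D (2 * K + 2) x d (singleCfg u))
    (Finset.mem_univ ⟨0, h0⟩)]
  have hcard : (Finset.univ.erase (⟨0, h0⟩ : Fin (2 * K + 2))).card = 2 * K + 1 := by
    rw [Finset.card_erase_of_mem (Finset.mem_univ _), Finset.card_univ, Fintype.card_fin]; omega
  have hedge : 1 + x / 6 * (x / 2) ^ d ≤ 1 + x * Phi1D (2 * K + 2) x d (singleCfg ⟨0, h0⟩) := by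
    have h1 := le_trans (walkerPhi_end_ge hx0 d h0) (walkerPhi_le_Phi1D_single hx0 d ⟨0, h0⟩)
    nlinarith [h1, hx0]
  have hbulk : (1 + x / 3 * (2 * x / 5) ^ d) ^ (2 * K + 1) ≤
      ∏ u ∈ Finset.univ.erase ⟨0, h0⟩, (1 + x * Phi1D (2 * K + 2) x d (singleCfg u)) := by
    have hc : (1 + x / 3 * (2 * x / 5) ^ d) ^ (2 * K + 1) =
        ∏ _u ∈ Finset.univ.erase (⟨0, h0⟩ : Fin (2 * K + 2)), (1 + x / 3 * (2 * x / 5) ^ d) := by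
      rw [Finset.prod_const, hcard]
    rw [hc]
    refine Finset.prod_le_prod (fun u _ => by positivity) (fun u _ => ?_)
    have h1 := le_trans (walkerPhi_ge_bulk K hx0 d u) (walkerPhi_le_Phi1D_single hx0 d u)
    nlinarith [h1, hx0]
  have he0 : 0 ≤ 1 + x / 6 * (x / 2) ^ d := by positivity
  exact mul_le_mul hedge hbulk (by positivity) (le_trans he0 hedge)

/-- Binomial truncation at second order. [folklore] -/
private theorem one_add_pow_ge_quad {a : ℝ} (ha : 0 ≤ a) : ∀ n : ℕ,
    1 + n * a + n * (n - 1) / 2 * a ^ 2 ≤ (1 + a) ^ n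
  | 0 => by simp
  | n + 1 => by
      have ih := one_add_pow_ge_quad ha n
      have h1 : 0 ≤ 1 + a := by linarith
      have step : (1 + a) * (1 + n * a + n * (n - 1) / 2 * a ^ 2) ≤ (1 + a) ^ (n + 1) := by
        rw [pow_succ, mul_comm]
        exact mul_le_mul_of_nonneg_right ih h1
      have hn : (0 : ℝ) ≤ n * (n - 1) := by
        cases n with
        | zero => simp
        | succ m => push_cast; nlinarith
      have key : (1 + a) * (1 + n * a + n * (n - 1) / 2 * a ^ 2) =
          1 + (n + 1) * a + (n + 1) * n / 2 * a ^ 2 + n * (n - 1) / 2 * a ^ 3 := by ring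
      have h3 : 0 ≤ n * (n - 1) / 2 * a ^ 3 := by positivity
      push_cast
      nlinarith [step, key, h3]

/-- THE FIRST TWO DILUTE-GAS SECTORS AS A FLOOR: with `a = (x/3)(2x/5)^d` and `N = 2K+2`,
`N a + N(N−1)/2 · a² ≤ E[XEB]_d` — the one-excitation term (the import lineage's linear floor
`singles_le_xebPlusOne1D`) PLUS the two-excitation (pair) term of the dilute flipped-spin expansion,
N-exponentially many more available from `xebPlusOne1D_ge_pow`. [cite: MorvanEtAl2024, SM App. E (arXiv p. 22: Eq. (E20), the k = 1 and k = 2 terms (1/k!)(e^{-εd} n/4^d)^k of the vacuum branch)] -/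
theorem xeb1D_pair_floor (K : ℕ) (hx0 : 0 ≤ x) (hx1 : x ≤ 1) (d : ℕ) :
    (2 * K + 2 : ℝ) * (x / 3 * (2 * x / 5) ^ d)
      + (2 * K + 2 : ℝ) * (2 * K + 1) / 2 * (x / 3 * (2 * x / 5) ^ d) ^ 2
      ≤ xebPlusOne1D (2 * K + 2) x d - 1 := by
  have ha : 0 ≤ x / 3 * (2 * x / 5) ^ d := by positivity
  have h := one_add_pow_ge_quad ha (2 * K + 2)
  have h2 := xebPlusOne1D_ge_pow K hx0 hx1 d
  push_cast at h
  nlinarith [h, h2]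

/-! ## §5 The k-excitation sectors: the lower half of the dilute-gas expansion, term by term -/

/-- The k-EXCITATION INPUT SECTOR of `E[XEB + 1]_d`: the total contribution
`x^k Σ_{|S| = k} Φ_d(S)` of the `C(N,k)` inputs with exactly `k` flipped spins (`k = 1` is the
import's `singleSector`, `kSector_one`). [cite: MorvanEtAl2024, SM App. E (arXiv p. 22: dilute flipped-spin expansion, Eq. (E20): the index k = the total number of flipped spins, with the 1/k! counting)] -/
noncomputable def kSector (N : ℕ) (x : ℝ) (d k : ℕ) : ℝ :=
  x ^ k * ∑ S ∈ Finset.powersetCard k (Finset.univ : Finset (Fin N)), Phi1D N x d (cfgOf S)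

/-- [folklore] -/
private theorem cfgOf_singleton (u : Fin N) : cfgOf ({u} : Finset (Fin N)) = singleCfg u := by
  funext v; by_cases hv : v = u <;> simp [cfgOf, singleCfg, hv]

/-- Consistency with the import: the 1-sector is `singleSector`. [cite: MorvanEtAl2024, SM App. E (arXiv p. 22: Eq. (E20), the k = 1 terms)] -/
theorem kSector_one (x : ℝ) (d : ℕ) : kSector N x d 1 = singleSector N x d := by
  unfold kSector singleSector
  rw [pow_one, Finset.powersetCard_one, Finset.sum_map]
  refine congrArg (fun r => x * r) (Finset.sum_congr rfl (fun u _ => ?_))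
  simp only [Function.Embedding.coeFn_mk]
  rw [cfgOf_singleton]

/-- k-SECTOR PRODUCT FLOOR: the k-excitation sector dominates the k-th elementary symmetric
function of the one-excitation functionals, `x^k e_k(Φ_d({·})) ≤ S_k(d)`, for every `k`, `N`, `d`,
`0 ≤ x ≤ 1` — the dilute-gas expansion's k-th term as a floor of the true k-sector. [cite: MorvanEtAl2024, SM App. E (arXiv p. 22: Eq. (E20), k flipped spins counted as k independent ones)] -/
theorem kSector_prod_floor (hx0 : 0 ≤ x) (hx1 : x ≤ 1) (d k : ℕ) :
    x ^ k * ∑ S ∈ Finset.powersetCard k (Finset.univ : Finset (Fin N)),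
        ∏ u ∈ S, Phi1D N x d (singleCfg u) ≤ kSector N x d k := by
  unfold kSector
  exact mul_le_mul_of_nonneg_left
    (Finset.sum_le_sum (fun S _ => Phi1D_prod_singles_le hx0 hx1 d S)) (pow_nonneg hx0 k)

/-- EXPLICIT k-SECTOR FLOOR on the even chain: every one of the `C(N,k)` inputs with `k` flipped
spins contributes at least `a^k`, `a = (x/3)(2x/5)^d`, so `C(N,k)·a^k ≤ S_k(d)` for every `k` —
the printed `(1/k!)(n e^{-εd}/4^d)^k` with the binomial in place of `n^k/k!` and the brickwork
rate. [cite: MorvanEtAl2024, SM App. E (arXiv p. 22: Eq. (E20), the k-th term of the vacuum branch)] -/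
theorem kSector_floor_bulk (K : ℕ) (hx0 : 0 ≤ x) (hx1 : x ≤ 1) (d k : ℕ) :
    ((2 * K + 2).choose k : ℝ) * (x / 3 * (2 * x / 5) ^ d) ^ k ≤ kSector (2 * K + 2) x d k := by
  refine le_trans ?_ (kSector_prod_floor hx0 hx1 d k)
  have hc : 0 ≤ 1 / 3 * (2 * x / 5) ^ d := by positivity
  have hterm : ∀ S ∈ Finset.powersetCard k (Finset.univ : Finset (Fin (2 * K + 2))),
      (1 / 3 * (2 * x / 5) ^ d) ^ k ≤ ∏ u ∈ S, Phi1D (2 * K + 2) x d (singleCfg u) := by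
    intro S hS
    rw [Finset.mem_powersetCard] at hS
    rw [← hS.2, ← Finset.prod_const]
    exact Finset.prod_le_prod (fun u _ => hc) (fun u _ =>
      le_trans (walkerPhi_ge_bulk K hx0 d u) (walkerPhi_le_Phi1D_single hx0 d u))
  have hsum := Finset.sum_le_sum hterm
  rw [Finset.sum_const, Finset.card_powersetCard, Finset.card_univ, Fintype.card_fin,
    nsmul_eq_mul] at hsum
  calc ((2 * K + 2).choose k : ℝ) * (x / 3 * (2 * x / 5) ^ d) ^ k
      = x ^ k * (((2 * K + 2).choose k : ℝ) * (1 / 3 * (2 * x / 5) ^ d) ^ k) := by ring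
    _ ≤ x ^ k * ∑ S ∈ Finset.powersetCard k (Finset.univ : Finset (Fin (2 * K + 2))),
          ∏ u ∈ S, Phi1D (2 * K + 2) x d (singleCfg u) :=
        mul_le_mul_of_nonneg_left hsum (pow_nonneg hx0 k)

/-! ## §6 The same laws in Mathlib's order language (corollaries, for citation) -/

/-- [folklore] -/
private theorem unionCfg_eq_sup (A B : Occ1D N) : unionCfg A B = A ⊔ B := by
  funext v; simp only [unionCfg, Pi.sup_apply]; cases A v <;> cases B v <;> rfl

/-- `Φ_t` is an antitone function on the Boolean lattice of configurations (`0 ≤ x ≤ 1`). [cite: DalzellHunterJonesBrandao2022, App. A and App. C (second-moment gate rule; the output law of an occupied bond does not depend on which of its sites are occupied)] -/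
theorem Phi1D_antitone' (hx0 : 0 ≤ x) (hx1 : x ≤ 1) (t : ℕ) : Antitone (Phi1D N x t) :=
  fun _ _ h => Phi1D_antitone hx0 hx1 t (fun v hv => Bool.le_iff_imp.mp (h v) hv)

/-- Supermultiplicativity for lattice-disjoint configurations: `Disjoint A B ⇒ Φ_t(A)·Φ_t(B) ≤
Φ_t(A ⊔ B)` (`0 ≤ x ≤ 1`). [cite: MorvanEtAl2024, SM App. E (arXiv p. 22: Eqs. (E20)–(E21), independent flipped spins)] -/
theorem Phi1D_supermul' (hx0 : 0 ≤ x) (hx1 : x ≤ 1) (t : ℕ) {A B : Occ1D N} (h : Disjoint A B) :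
    Phi1D N x t A * Phi1D N x t B ≤ Phi1D N x t (A ⊔ B) := by
  rw [← unionCfg_eq_sup]
  refine Phi1D_supermul hx0 hx1 t (fun v => ?_)
  have hv := (Pi.disjoint_iff.mp h) v
  revert hv
  cases A v <;> cases B v <;> simp [disjoint_iff]

end Main

end Literature.Computability.QuantumComplexity.OpenChainDiluteGasFloor
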